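import Summits.ResolutionOfSingularities.ResolutionOfSingularities.Theorems.HomologicalConductorNoZenoRRelativelyMinimal
import Summits.ResolutionOfSingularities.ResolutionOfSingularities.Theorems.HomologicalConductorNoZenoRLipman12B
import Summits.ResolutionOfSingularities.ResolutionOfSingularities.Theorems.HomologicalConductorNoZenoStalkDimTwo
import Literature.AlgebraicGeometry.Resolution.ResolutionWithoutExceptionalCurves
import Literature.AlgebraicGeometry.Resolution.ResolutionClosedPointCartier
import Literature.AlgebraicGeometry.Resolution.EmbeddedCurvePointBlowups
import HarnessLib

/-!
# Crux `NoZenoR` (stmt-ResolutionOfSingularities-19943) — the consumed form of Lipman (4.1) («`Spec S` has a MINIMAL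
# desingularization») REDUCED to the ONE-BLOW-UP DESCENT of morphisms into a candidate

Route `ResolutionOfSingularities/HomologicalConductor` (cell decomp-res, hand leafhand-res-homologicalconduct-16 g3).
OURS: AI-written bookkeeping over tree theorems, weaker than expert review; nothing here is a statement of the
manuscript under review (Hironaka 2017).  SUPPORT level, counted 0.  Def-free, no new named facts.

The W3 print `Lipman1969_4_1` enters the `NoZenoR` chain through `Lipman1969_4_1.exists_isMinimalResolution_Spec`:
«a two-dimensional normal local domain with a rational singularity has a minimal desingularization».  With Lipman's
(1.2) B) (`Lipman12B.Lipman1969_1_2_B_holds`) and Zariski's factorisation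
(`FirstKind.exists_isPointBlowupComposition_of_fac`, hand 18 g1) both theorems of the tree, the universal property of
a candidate desingularization `π_r : X_r → Spec S` reduces to the ONE-BLOW-UP DESCENT (D): «every `S`-morphism
`Z' → X_r` from the blowing up `Z'` of a desingularization `Z₁` at a closed point descends to `Z₁ → X_r`» — by induction
along the point-blow-up tower dominating an arbitrary desingularization.  (D) is where Castelnuovo-type input lives
(rigidity of the contraction when the exceptional curve is contracted; exclusion of the other case on a relatively
minimal `X_r`); it is NOT proved here.

* `ringKrullDim_stalk_eq_two_of_isClosed` — closed points of a desingularization of a two-dimensional Noetherian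
  local normal domain have two-dimensional local rings (with or without exceptional curves);
* `isResolution_comp` — a desingularization of a desingularization is a desingularization;
* `isResolution_comp_of_isPointBlowupComposition` — a point-blow-up tower over a desingularization is one;
* `isMinimalResolution_of_descent` — **(D) for `π_r` ⇒ `π_r` is THE minimal desingularization**;
* `exists_isMinimalResolution_of_descent` — hence «(D) for every relatively minimal desingularization ⇒ `Spec S` has a
  minimal desingularization» as soon as it has one desingularization (`NoZeno.FirstKind.exists_forall_isIso_of_hasResolution`),
  e.g. for a rational singularity (`exists_isMinimalResolution_of_descent_of_hasRationalSingularity`).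

No crux or summit statement is proved here.
-/

noncomputable section

-- single-problem summit: the doubled namespace component `ResolutionOfSingularities` is forced
set_option linter.dupNamespace false

open CategoryTheory AlgebraicGeometry TopologicalSpace Topology IsLocalRing
open Literature.AlgebraicGeometry.Resolution Scheme.IdealSheafData

namespace Summit.ResolutionOfSingularities.ResolutionOfSingularities.Theorems.NoZeno.ExcCount.FirstKind

variable {S : Type} [CommRing S] [IsNoetherianRing S] [IsLocalRing S] [IsDomain S] [IsIntegrallyClosed S]

/-! ## Closed points of a desingularization have two-dimensional local rings -/

/-- **`dim 𝒪_{X,x} = 2` at every CLOSED point of a desingularization `π : X → Spec S` of a two-dimensional Noetherian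
local normal domain** — if `π` has an exceptional curve this is the tree's
`IsResolution.ringKrullDim_stalk_eq_two_of_isClosed_of_nonempty`; otherwise the closed fibre is a point, `π` is an
isomorphism (`IsResolution.isIso_of_closedFibre_subsingleton`) and `𝒪_{X,x} ≅ S_𝔪 = S`.
[cite: Lipman1969, Section 12 (p. 220)] -/
theorem ringKrullDim_stalk_eq_two_of_isClosed (h2 : ringKrullDim S = 2) {X : Scheme.{0}}
    {π : X ⟶ Spec (.of S)} (hπ : IsResolution π) {x : X} (hx : IsClosed ({x} : Set X)) :
    ringKrullDim (X.presheaf.stalk x) = 2 := by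
  haveI : IsProper π := hπ.isProper
  have hxm : π.base x = closedPoint S := base_eq_closedPoint_of_isClosed π hx
  by_cases hne : (excCurvePoints π).Nonempty
  · exact hπ.ringKrullDim_stalk_eq_two_of_isClosed_of_nonempty h2 hne hxm hx
  · rw [Set.not_nonempty_iff_eq_empty] at hne
    haveI : IsIso π := hπ.isIso_of_closedFibre_subsingleton
      (hπ.closedFibre_subsingleton_of_excCurvePoints_eq_empty h2 hne)
    have e : (Spec (.of S)).presheaf.stalk (π.base x) ≃+* X.presheaf.stalk x :=
      (asIso (π.stalkMap x)).commRingCatIsoToRingEquiv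
    rw [← ringKrullDim_eq_of_ringEquiv e, hxm, ringKrullDim_stalk_closedPoint S, h2]

/-! ## Towers of desingularizations -/

omit [IsNoetherianRing S] [IsLocalRing S] [IsDomain S] [IsIntegrallyClosed S] in
/-- A desingularization of (the source of) a desingularization is a desingularization of the base. [folklore] -/
theorem isResolution_comp {X Y : Scheme.{0}} {ρ : Y ⟶ Spec (.of S)} {j : X ⟶ Y}
    (hj : IsResolution j) (hρ : IsResolution ρ) : IsResolution (j ≫ ρ) := by
  haveI := hj.isProper
  haveI := hρ.isProper
  exact ⟨inferInstance, hj.isBirational.comp hρ.isBirational, hj.isRegular⟩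

omit [IsLocalRing S] [IsIntegrallyClosed S] in
/-- **A point-blow-up tower over a desingularization is a desingularization** (`IsPointBlowupComposition`: proper,
integral source, birational; regular with `dim ≤ 2` by `Lipman12B.IsPointBlowupComposition.invariants_noexc`).
[cite: Liu2002, Thm. 8.1.19] -/
theorem isResolution_comp_of_isPointBlowupComposition (h2 : ringKrullDim S = 2) {Z : Scheme.{0}}
    {ρ : Z ⟶ Spec (.of S)} (hρ : IsResolution ρ) {T : Set Z} {W : Scheme.{0}} {q : W ⟶ Z}
    (hq : IsPointBlowupComposition T q) : IsResolution (q ≫ ρ) := by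
  haveI : IsIntegral Z := hρ.isIntegral_source
  haveI : IsProper ρ := hρ.isProper
  haveI : IsNoetherian Z := by
    haveI : IsLocallyNoetherian Z := LocallyOfFiniteType.isLocallyNoetherian ρ
    haveI : CompactSpace Z := QuasiCompact.compactSpace_of_compactSpace ρ
    exact {}
  have hdimZ : topologicalKrullDim Z ≤ 2 := by
    refine hρ.topologicalKrullDim_le.trans ?_
    change topologicalKrullDim (PrimeSpectrum S) ≤ 2
    rw [PrimeSpectrum.topologicalKrullDim_eq_ringKrullDim]
    exact h2.le
  obtain ⟨-, hreg, -⟩ := Lipman12B.IsPointBlowupComposition.invariants_noexc hq hρ.isRegular hdimZ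
  haveI : IsProper q := hq.isProper inferInstance
  exact ⟨inferInstance, (hq.isBirational inferInstance).comp hρ.isBirational, hreg⟩

/-! ## The universal property from the one-blow-up descent -/

/-- **The minimal desingularization from the ONE-BLOW-UP DESCENT (D).**  Let `S` be a two-dimensional Noetherian local
normal domain and `π_r : X_r → Spec S` a desingularization such that (D): for every desingularization
`g₁ : Z₁ → Spec S`, every blowing up `τ : Z' → Z₁` of a closed point `z₁` (`dim 𝒪_{Z₁,z₁} = 2`) and every
`S`-morphism `h : Z' → X_r` there is an `S`-morphism `h₁ : Z₁ → X_r` with `τ ≫ h₁ = h`.  THEN `π_r` is the minimal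
desingularization: every desingularization `ρ : Z → Spec S` factors through `π_r`.  Proof: dominate `Z` and `X_r` by a
desingularization `Z'` (Lipman (1.2) B), `Lipman12B.Lipman1969_1_2_B_holds`); `Z' → Z` is, up to isomorphism, a
point-blow-up tower (Zariski, `FirstKind.exists_isPointBlowupComposition_of_fac`); descend `Z' → X_r` down the tower
by (D), one blow-up at a time (induction on `IsPointBlowupComposition`).
[cite: Lipman1969, Theorem (4.1) (p. 204) and Corollary (27.3), proof ¶1 (p. 277)]; [cite: StacksProject, Tag 0C5R] -/
theorem isMinimalResolution_of_descent (h2 : ringKrullDim S = 2) {Xr : Scheme.{0}}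
    {πr : Xr ⟶ Spec (.of S)} (hπr : IsResolution πr)
    (hD : ∀ (Z₁ Z' : Scheme.{0}) (g₁ : Z₁ ⟶ Spec (.of S)) (τ : Z' ⟶ Z₁) (z₁ : Z₁)
      (hz₁ : IsClosed ({z₁} : Set Z₁)), IsResolution g₁ → ringKrullDim (Z₁.presheaf.stalk z₁) = 2 →
      IsBlowup τ (vanishingIdeal ⟨{z₁}, hz₁⟩) → ∀ h : Z' ⟶ Xr, h ≫ πr = τ ≫ g₁ →
        ∃ h₁ : Z₁ ⟶ Xr, τ ≫ h₁ = h ∧ h₁ ≫ πr = g₁) :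
    IsMinimalResolution πr := by
  refine ⟨hπr, fun Z ρ hρ => ?_⟩
  haveI : IsIntegral Xr := hπr.isIntegral_source
  haveI : IsProper πr := hπr.isProper
  -- dominate `Z` and `X_r`
  obtain ⟨Z', j, h, hj, hfac⟩ := Lipman12B.Lipman1969_1_2_B_holds S h2 Z ρ hρ Xr πr hπr.isBirational
  -- factorise `j` into point blow-ups
  have hjρ : IsResolution (j ≫ ρ) := isResolution_comp hj hρ
  obtain ⟨Z'', e, he, p, hp, hep⟩ :=
    NoZeno.FirstKind.exists_isPointBlowupComposition_of_fac h2 hjρ Z ρ j hρ rfl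
  -- descend along the tower
  have key : ∀ {W : Scheme.{0}} {q : W ⟶ Z}, IsPointBlowupComposition (ρ.base ⁻¹' {closedPoint S}) q →
      ∀ k : W ⟶ Xr, k ≫ πr = q ≫ ρ → ∃ m : Z ⟶ Xr, m ≫ πr = ρ := by
    intro W q hq
    induction hq with
    | nil =>
      intro k hk
      exact ⟨k, by simpa using hk⟩
    | cons τ σ x' hx' hσ hne hT hτ ih =>
      intro k hk
      have hσρ : IsResolution (σ ≫ ρ) := isResolution_comp_of_isPointBlowupComposition h2 hρ hσ
      have hx'2 := ringKrullDim_stalk_eq_two_of_isClosed h2 hσρ hx'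
      obtain ⟨k₁, -, hk₁⟩ := hD _ _ (σ ≫ ρ) τ x' hx' hσρ hx'2 hτ k (by rw [hk, Category.assoc])
      exact ih k₁ hk₁
  haveI := he
  exact key hp (inv e ≫ h) (by rw [Category.assoc, hfac, ← hep, Category.assoc, IsIso.inv_hom_id_assoc])

/-- **A minimal desingularization EXISTS as soon as (D) holds for every relatively minimal desingularization** (and
`Spec S` has a desingularization): every desingularization dominates a relatively minimal one
(`NoZeno.FirstKind.exists_forall_isIso_of_hasResolution`, hand 18 g1), which is minimal by `isMinimalResolution_of_descent`.  This is
the exact residual of the consumed form `Lipman1969_4_1.exists_isMinimalResolution_Spec` of the W3 print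
`Lipman1969_4_1`. [cite: Lipman1969, Theorem (4.1) (p. 204)] -/
theorem exists_isMinimalResolution_of_descent (h2 : ringKrullDim S = 2)
    (hres : Scheme.HasResolution (Spec (.of S)))
    (hD : ∀ (Xr : Scheme.{0}) (πr : Xr ⟶ Spec (.of S)), IsResolution πr →
      (∀ (X' : Scheme.{0}) (f' : X' ⟶ Spec (.of S)) (k' : Xr ⟶ X'), IsResolution f' → k' ≫ f' = πr → IsIso k') →
      ∀ (Z₁ Z' : Scheme.{0}) (g₁ : Z₁ ⟶ Spec (.of S)) (τ : Z' ⟶ Z₁) (z₁ : Z₁)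
        (hz₁ : IsClosed ({z₁} : Set Z₁)), IsResolution g₁ → ringKrullDim (Z₁.presheaf.stalk z₁) = 2 →
        IsBlowup τ (vanishingIdeal ⟨{z₁}, hz₁⟩) → ∀ h : Z' ⟶ Xr, h ≫ πr = τ ≫ g₁ →
          ∃ h₁ : Z₁ ⟶ Xr, τ ≫ h₁ = h ∧ h₁ ≫ πr = g₁) :
    ∃ (X : Scheme.{0}) (f : X ⟶ Spec (.of S)), IsMinimalResolution f := by
  obtain ⟨Xr, πr, hπr, hrel⟩ := NoZeno.FirstKind.exists_forall_isIso_of_hasResolution h2 hres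
  exact ⟨Xr, πr, isMinimalResolution_of_descent h2 hπr (hD Xr πr hπr hrel)⟩

/-- **Rational singularities**: (D) for the relatively minimal desingularizations of `Spec S` ⇒ the conclusion of
`Lipman1969_4_1.exists_isMinimalResolution_Spec` for `S` (a desingularization exists by Definition (1.1)).
[cite: Lipman1969, Definition (1.1) (p. 199) and Theorem (4.1) (p. 204)] -/
theorem exists_isMinimalResolution_of_descent_of_hasRationalSingularity (h2 : ringKrullDim S = 2)
    (hS : HasRationalSingularity S)
    (hD : ∀ (Xr : Scheme.{0}) (πr : Xr ⟶ Spec (.of S)), IsResolution πr →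
      (∀ (X' : Scheme.{0}) (f' : X' ⟶ Spec (.of S)) (k' : Xr ⟶ X'), IsResolution f' → k' ≫ f' = πr → IsIso k') →
      ∀ (Z₁ Z' : Scheme.{0}) (g₁ : Z₁ ⟶ Spec (.of S)) (τ : Z' ⟶ Z₁) (z₁ : Z₁)
        (hz₁ : IsClosed ({z₁} : Set Z₁)), IsResolution g₁ → ringKrullDim (Z₁.presheaf.stalk z₁) = 2 →
        IsBlowup τ (vanishingIdeal ⟨{z₁}, hz₁⟩) → ∀ h : Z' ⟶ Xr, h ≫ πr = τ ≫ g₁ →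
          ∃ h₁ : Z₁ ⟶ Xr, τ ≫ h₁ = h ∧ h₁ ≫ πr = g₁) :
    ∃ (X : Scheme.{0}) (f : X ⟶ Spec (.of S)), IsMinimalResolution f := by
  obtain ⟨X₀, f₀, hf₀, -⟩ := hS
  exact exists_isMinimalResolution_of_descent h2 ⟨X₀, f₀, hf₀⟩ hD

end Summit.ResolutionOfSingularities.ResolutionOfSingularities.Theorems.NoZeno.ExcCount.FirstKind

end
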